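import Summits.ResolutionOfSingularities.ResolutionOfSingularities.Theorems.WildQuotientsSummitReductionStubPairOrbitBlowupCentreLocalLemmas
import Literature.AlgebraicGeometry.Resolution.StrictNormalCrossingsAt
import Literature.AlgebraicGeometry.Resolution.AlterationsNodeLocalStructure
import HarnessLib

/-!
# `WildQuotients.SummitReduction` (stmt-ResolutionOfSingularities-16324), line `FramePerfect`, stub NB2
# (`stub_pair_orbitNormalFormBlowup_modelChartsOverCentre`): transport of the chart package along an
# isomorphism of local rings

Route `ResolutionOfSingularities/WildQuotients`, crux `SummitReduction`; helper file of stub NB2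
(de Jong 1996, 4.27 [C2] on the coefficient-free model). The conclusion of NB2 at a closed point `y`
of the blown-up model — the exceptional ideal `(G)` with `G` a non-zero-divisor, the boundary
`(G² w)`, the completed radical `(G w) 𝒪̂`, local strict normal crossings data for `(G w)` at a
regular point and a normal form `𝒪̂ ≅ A'⟦u, v⟧/(uv - ∏_{i<s'} t'ᵢ)` carrying `(G w) 𝒪̂` to
`(∏_{i<r'} t'ᵢ)` at a singular one — is computed in the local ring `O' = L/(f)` of a chart and
has to be moved back to `O = 𝒪_{B,y}` along `Θ : O ≅ O'`. PROVED here (the step "C" of the line's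
plan): `modelChartsOverCentre_transport` — everything is invariant under `Θ` and the induced
isomorphism of `𝔪`-adic completions (`exists_localCpl_equiv_of_ringEquiv`,
`IsRegularLocalRing.of_ringEquiv`, `IsSNCIdeal.of_ringEquiv`).

## Sources

* A. J. de Jong, *Smoothness, semi-stability and alterations*, Publ. Math. IHÉS 83 (1996), 4.27,
  pp. 75–76. [DeJong1996]
* H. Matsumura, *Commutative Ring Theory* (1986), Thm. 8.11 (completions). [Matsumura1987]
-/

set_option linter.dupNamespace false -- the tree's summit namespace repeats `ResolutionOfSingularities`

noncomputable section

open IsLocalRing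
open Literature.AlgebraicGeometry.Resolution

namespace Summit.ResolutionOfSingularities.ResolutionOfSingularities.Theorems

/-- Extension of ideals to the completions commutes with an isomorphism of local rings and the
induced isomorphism of completions. [folklore] -/
theorem modelChartsOverCentre_map_map_completion {O O' : Type} [CommRing O] [CommRing O']
    [IsLocalRing O] [IsLocalRing O'] (Θ : O ≃+* O')
    (E : AdicCompletion (maximalIdeal O) O ≃+* AdicCompletion (maximalIdeal O') O')
    (hE : ∀ r : O, E (AdicCompletion.of _ _ r) = AdicCompletion.of _ _ (Θ r)) (I : Ideal O) :
    (I.map (algebraMap O (AdicCompletion (maximalIdeal O) O))).map (E : _ →+* _) =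
      (I.map (Θ : O →+* O')).map (algebraMap O' (AdicCompletion (maximalIdeal O') O')) := by
  rw [Ideal.map_map, Ideal.map_map]
  congr 1
  exact RingHom.ext fun r => hE r

set_option maxHeartbeats 1000000 in
/-- **Transport of the chart package along an isomorphism of local rings** `Θ : O ≅ O'`: if the
ideals `I_c, I_b ⊆ O` go to `(G')`, `(J')` with `G'` a non-zero-divisor, `(J') = (G'² w')`,
`√((J') Ô') = (G' w') Ô'`, local strict normal crossings data for `(G' w')` when `O'` is regular
and a normal form `Ô' ≅ A'⟦u, v⟧/(uv - ∏_{i<s'} t'ᵢ)` carrying `(G' w') Ô'` to `(∏_{i<r'} t'ᵢ)` when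
not, then the same holds in `O` with `G = Θ⁻¹ G'`, `w = Θ⁻¹ w'` (isomorphisms of local rings
extend to the completions). [folklore] -/
theorem modelChartsOverCentre_transport {O O' : Type} [CommRing O] [CommRing O']
    [IsLocalRing O] [IsLocalRing O'] (Θ : O ≃+* O') {Ic Ib : Ideal O} {G' J' : O'} {m : ℕ}
    (hc : Ic.map (Θ : O →+* O') = Ideal.span {G'}) (hb : Ib.map (Θ : O →+* O') = Ideal.span {J'})
    (hG : G' ∈ nonZeroDivisors O')
    (hpack : ∃ w' : O', Ideal.span {J'} = Ideal.span {G' ^ 2 * w'} ∧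
      ((Ideal.span {J'}).map (algebraMap O' (AdicCompletion (maximalIdeal O') O'))).radical =
        (Ideal.span {G' * w'}).map (algebraMap O' (AdicCompletion (maximalIdeal O') O')) ∧
      (IsRegularLocalRing O' → IsSNCIdeal (Ideal.span {G' * w'})) ∧
      (¬ IsRegularLocalRing O' →
        ∃ (A' : Type) (_ : CommRing A') (_ : IsRegularLocalRing A') (t' : Fin m → A') (s' r' : ℕ),
          Ideal.span (Set.range t') = maximalIdeal A' ∧ ringKrullDim A' = m ∧
          2 ≤ s' ∧ s' ≤ r' ∧ r' ≤ m ∧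
          ∃ e : AdicCompletion (maximalIdeal O') O' ≃+*
              DeJong1996.NodeDeformationRing A'
                (∏ i ∈ Finset.univ.filter (fun i : Fin m => i.val < s'), t' i),
            ((Ideal.span {G' * w'}).map (algebraMap O' _)).map e.toRingHom =
              Ideal.span {DeJong1996.NodeDeformationRing.ofBase A' _
                (∏ i ∈ Finset.univ.filter (fun i : Fin m => i.val < r'), t' i)})) :
    ∃ G w : O,
      Ic = Ideal.span {G} ∧ G ∈ nonZeroDivisors O ∧ Ib = Ideal.span {G ^ 2 * w} ∧
      ((Ib.map (algebraMap O (AdicCompletion (maximalIdeal O) O))).radical =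
        (Ideal.span {G * w}).map (algebraMap O (AdicCompletion (maximalIdeal O) O))) ∧
      (IsRegularLocalRing O → IsSNCIdeal (Ideal.span {G * w})) ∧
      (¬ IsRegularLocalRing O →
        ∃ (A' : Type) (_ : CommRing A') (_ : IsRegularLocalRing A') (t' : Fin m → A') (s' r' : ℕ),
          Ideal.span (Set.range t') = maximalIdeal A' ∧ ringKrullDim A' = m ∧
          2 ≤ s' ∧ s' ≤ r' ∧ r' ≤ m ∧
          ∃ e : AdicCompletion (maximalIdeal O) O ≃+*
              DeJong1996.NodeDeformationRing A'
                (∏ i ∈ Finset.univ.filter (fun i : Fin m => i.val < s'), t' i),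
            ((Ideal.span {G * w}).map (algebraMap O _)).map e.toRingHom =
              Ideal.span {DeJong1996.NodeDeformationRing.ofBase A' _
                (∏ i ∈ Finset.univ.filter (fun i : Fin m => i.val < r'), t' i)}) := by
  obtain ⟨w', hJ, hrad, hreg, hnode⟩ := hpack
  obtain ⟨E, hE⟩ := exists_localCpl_equiv_of_ringEquiv Θ
  have hmm := modelChartsOverCentre_map_map_completion Θ E hE
  -- pulling back along `Θ`
  have hback : ∀ (I : Ideal O) (x : O'), I.map (Θ : O →+* O') = Ideal.span {x} →
      I = Ideal.span {Θ.symm x} := by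
    intro I x h
    rw [← Ideal.map_of_equiv (I := I) Θ, h, Ideal.map_span, Set.image_singleton, RingHom.coe_coe]
  have hGw : (Ideal.span {Θ.symm G' * Θ.symm w'}).map (Θ : O →+* O') = Ideal.span {G' * w'} := by
    rw [Ideal.map_span, Set.image_singleton, RingHom.coe_coe, map_mul, RingEquiv.apply_symm_apply,
      RingEquiv.apply_symm_apply]
  have hregiff : IsRegularLocalRing O ↔ IsRegularLocalRing O' :=
    ⟨fun h => IsRegularLocalRing.of_ringEquiv Θ, fun h => IsRegularLocalRing.of_ringEquiv Θ.symm⟩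
  have hIb : Ib = Ideal.span {Θ.symm G' ^ 2 * Θ.symm w'} := by
    have h := hback Ib _ (hb.trans hJ)
    rwa [map_mul, map_pow] at h
  refine ⟨Θ.symm G', Θ.symm w', hback _ _ hc, ?_, hIb, ?_, fun hO => ?_, fun hO => ?_⟩
  · exact mem_nonZeroDivisors_of_injective (f := (Θ : O →+* O')) Θ.injective
      (by rw [RingHom.coe_coe, RingEquiv.apply_symm_apply]; exact hG)
  · -- radicals in the completions
    rw [← Ideal.map_of_equiv (I := (Ib.map (algebraMap O (AdicCompletion (maximalIdeal O) O))).radical) E,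
      Ideal.map_radical_of_surjective (f := (E : LocalCpl O →+* LocalCpl O'))
        (fun x => ⟨E.symm x, E.apply_symm_apply x⟩) (by simp),
      hmm, hb, hrad, ← hGw, ← hmm, Ideal.map_of_equiv]
  · have h := IsSNCIdeal.of_ringEquiv Θ.symm (hreg (hregiff.mp hO))
    rw [Ideal.map_span, Set.image_singleton, RingHom.coe_coe, map_mul] at h
    exact h
  · obtain ⟨A', _, _, t', s', r', hsp, hdim, hs, hsr, hrm, e, he⟩ := hnode (fun h => hO (hregiff.mpr h))
    refine ⟨A', _, ‹_›, t', s', r', hsp, hdim, hs, hsr, hrm, E.trans e, ?_⟩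
    rw [RingEquiv.toRingHom_eq_coe, RingEquiv.coe_ringHom_trans, ← Ideal.map_map, hmm, hGw,
      ← RingEquiv.toRingHom_eq_coe e, he]

end Summit.ResolutionOfSingularities.ResolutionOfSingularities.Theorems

end
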